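import Summits.MatrixMultiplication.MatrixMultiplication.Theorems.TetrahedronTensorKronecker
import Mathlib.Analysis.SpecialFunctions.Log.Base
import HarnessLib

/-!
# Tetrahedron tensor — the exponent IS the infimum of the level certificates

Converse of the finite-certificate lemma `omegaTetra_le_four_of_levels` (Kronecker file): from the
definition of `ω(K₄)` as an infimum of admissible exponents, every `θ > ω(K₄)` is certified by SOME
level, `R₄(T(K₄)_N) ≤ N^θ` with `N ≥ 2` (`exists_level_of_omegaTetra_lt`). Hence the attacked conjunct
`TetraFlat : ω(K₄) ≤ 4` of the tetrahedron carving is EQUIVALENT to its finite-certificate form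
(`omegaTetra_le_four_iff_levels`) — the BC3 skeleton's open stub `stub_levels` loses nothing — and the
exponent has the level formula **`ω(K₄) = inf_{N ≥ 2} log_N R₄(T(K₄)_N)`** (`omegaTetra_eq_sInf_levels`;
the `≤` half is the sub-multiplicativity `R₄(T(K₄)_{NM}) ≤ R₄(T(K₄)_N) R₄(T(K₄)_M)`, the `≥` half is this
file). Decomposition-workshop lens 6 (g13). Sorry-free.
-/

noncomputable section

set_option linter.dupNamespace false

namespace Summit.MatrixMultiplication.MatrixMultiplication.Theorems.TetrahedronTensor

open Filter Asymptotics Literature.Computability.AlgebraicComplexity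

variable (F : Type) [Field F]

/-- **Levels from the exponent**: if `ω(K₄) < θ` then some level `N ≥ 2` carries the certificate
`R₄(T(K₄)_N) ≤ N^θ`. [cite: ChristandlVranaZuiddam2016, Prop. 1.1.16] -/
theorem exists_level_of_omegaTetra_lt {θ : ℝ} (h : omegaTetra F < θ) :
    ∃ N : ℕ, 2 ≤ N ∧ (tensorRankD (tetra F N) : ℝ) ≤ (N : ℝ) ^ θ := by
  obtain ⟨β, hωβ, hβθ⟩ := exists_between h
  have hβ := mem_tetraAdmissibleExponents_of_lt F hωβ
  obtain ⟨C, hC⟩ := isBigO_iff.1 hβ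
  have hlim : Tendsto (fun n : ℕ => (n : ℝ) ^ (θ - β)) atTop atTop :=
    (tendsto_rpow_atTop (by linarith)).comp tendsto_natCast_atTop_atTop
  obtain ⟨N, hRN, hCN, hN2⟩ :=
    (hC.and ((hlim.eventually_ge_atTop C).and (eventually_ge_atTop 2))).exists
  refine ⟨N, hN2, ?_⟩
  have hN0 : (0 : ℝ) < N := by
    have : 0 < N := lt_of_lt_of_le (by norm_num) hN2
    exact_mod_cast this
  rw [Real.norm_of_nonneg (Nat.cast_nonneg _),
    Real.norm_of_nonneg (Real.rpow_nonneg (Nat.cast_nonneg _) _)] at hRN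
  calc (tensorRankD (tetra F N) : ℝ) ≤ C * (N : ℝ) ^ β := hRN
    _ ≤ (N : ℝ) ^ (θ - β) * (N : ℝ) ^ β :=
        mul_le_mul_of_nonneg_right hCN (Real.rpow_nonneg hN0.le _)
    _ = (N : ℝ) ^ θ := by rw [← Real.rpow_add hN0, sub_add_cancel]

/-- `TetraFlat` in finite-certificate form, converse direction: `ω(K₄) ≤ 4` gives, for every `k`, a
level `N ≥ 2` with `R₄(T(K₄)_N) ≤ N^{4 + 1/(k+1)}`. [cite: ChristandlVranaZuiddam2016, Prop. 1.1.16] -/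
theorem levels_of_omegaTetra_le_four (h : omegaTetra F ≤ 4) :
    ∀ k : ℕ, ∃ N : ℕ, 2 ≤ N ∧
      (tensorRankD (tetra F N) : ℝ) ≤ (N : ℝ) ^ ((4 : ℝ) + 1 / ((k : ℝ) + 1)) := by
  intro k
  refine exists_level_of_omegaTetra_lt F (lt_of_le_of_lt h ?_)
  have hk : (0 : ℝ) < 1 / ((k : ℝ) + 1) := by positivity
  linarith

/-- **`TetraFlat ⟺ Levels`**: `ω(K₄) ≤ 4` iff every exponent `4 + 1/(k+1)` is certified at some finite
level (the BC3 skeleton's open stub is an exact reformulation of the crux). [cite: ChristandlVranaZuiddam2016, Prop. 1.1.16] -/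
theorem omegaTetra_le_four_iff_levels :
    omegaTetra F ≤ 4 ↔
      ∀ k : ℕ, ∃ N : ℕ, 2 ≤ N ∧
        (tensorRankD (tetra F N) : ℝ) ≤ (N : ℝ) ^ ((4 : ℝ) + 1 / ((k : ℝ) + 1)) :=
  ⟨levels_of_omegaTetra_le_four F, omegaTetra_le_four_of_levels F⟩

/-! ## The level formula `ω(K₄) = inf_{N ≥ 2} log_N R₄(T(K₄)_N)` -/

/-- The set of level exponents `{log_N R₄(T(K₄)_N) : N ≥ 2}`. (CVZ19, Prop. 1.1.16). -/
def levelExponents : Set ℝ :=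
  {x : ℝ | ∃ N : ℕ, 2 ≤ N ∧ x = Real.logb N (tensorRankD (tetra F N))}

/-- `R₄(T(K₄)_N) ≥ 1` as a real number for `N ≥ 1` (from the flattening bound `N⁴ ≤ R₄`). [folklore] -/
theorem one_le_tensorRankD_tetra_real {N : ℕ} (hN : 1 ≤ N) :
    (1 : ℝ) ≤ (tensorRankD (tetra F N) : ℝ) := by
  have h4 := pow_four_le_tensorRankD_tetra' (F := F) N
  have h1 : 1 ≤ N ^ 4 := Nat.one_le_pow _ _ hN
  exact_mod_cast h1.trans h4

/-- Every level exponent bounds `ω(K₄)`: `ω(K₄) ≤ log_N R₄(T(K₄)_N)` for `N ≥ 2` (one certificate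
suffices, `omegaTetra_le_of_level` with `θ = log_N R₄`). [cite: ChristandlVranaZuiddam2016, Prop. 1.1.16] -/
theorem omegaTetra_le_logb_level {N : ℕ} (hN : 2 ≤ N) :
    omegaTetra F ≤ Real.logb N (tensorRankD (tetra F N)) := by
  have hN1 : (1 : ℝ) < N := by exact_mod_cast (lt_of_lt_of_le (by norm_num) hN : 1 < N)
  have hN0 : (0 : ℝ) < N := by linarith
  have hR1 := one_le_tensorRankD_tetra_real F (le_trans (by norm_num) hN)
  have hR0 : (0 : ℝ) < (tensorRankD (tetra F N) : ℝ) := by linarith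
  refine omegaTetra_le_of_level F hN (Real.logb_nonneg hN1 hR1) ?_
  rw [Real.rpow_logb hN0 hN1.ne' hR0]

/-- The level exponents are nonempty (`N = 2`). [folklore] -/
theorem levelExponents_nonempty : (levelExponents F).Nonempty :=
  ⟨_, 2, le_rfl, rfl⟩

/-- The level exponents are bounded below by `ω(K₄)`. [folklore] -/
theorem levelExponents_bddBelow : BddBelow (levelExponents F) := by
  refine ⟨omegaTetra F, fun x hx => ?_⟩
  obtain ⟨N, hN, rfl⟩ := hx
  exact omegaTetra_le_logb_level F hN

/-- **Level formula**: `ω(K₄) = inf {log_N R₄(T(K₄)_N) : N ≥ 2}` — the exponent of the tetrahedron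
is exactly the infimum of its finite level certificates. [cite: ChristandlVranaZuiddam2016, Prop. 1.1.16] -/
theorem omegaTetra_eq_sInf_levels : omegaTetra F = sInf (levelExponents F) := by
  refine le_antisymm (le_csInf (levelExponents_nonempty F) fun x hx => ?_) ?_
  · obtain ⟨N, hN, rfl⟩ := hx
    exact omegaTetra_le_logb_level F hN
  · refine le_of_forall_gt_imp_ge_of_dense fun θ hθ => ?_
    obtain ⟨N, hN, hcert⟩ := exists_level_of_omegaTetra_lt F hθ
    have hN1 : (1 : ℝ) < N := by exact_mod_cast (lt_of_lt_of_le (by norm_num) hN : 1 < N)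
    have hR1 := one_le_tensorRankD_tetra_real F (le_trans (by norm_num) hN)
    have hR0 : (0 : ℝ) < (tensorRankD (tetra F N) : ℝ) := by linarith
    have hlog : Real.logb N (tensorRankD (tetra F N)) ≤ θ :=
      (Real.logb_le_iff_le_rpow hN1 hR0).2 hcert
    exact (csInf_le (levelExponents_bddBelow F) ⟨N, hN, rfl⟩).trans hlog

end Summit.MatrixMultiplication.MatrixMultiplication.Theorems.TetrahedronTensor

end
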